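/-
Copyright (c) 2026 the pub-hodgecm-mathlib formalisation cell (harness21).  Prover seat hodgecm-mathlib-K2E3-p05 (g0), Track B «K2-LIT»,
engine E3 «EllipticInputs», unit U4 «Keys», 2026-09-03.  KERNEL module: THEOREMS ONLY (no definition, no named fact, no `sorry`,
no instance, no notation).
-/
import Summits.HodgeConjecture.HodgeConjecture.Theorems.F0P3cStCharTSTorusRay                   -- ★ `exists_uniformizer_units`, `exists_zpow_mul_of_nonsplit` (`E_vˣ = ϖ^ℤ · 𝒪_vˣ`), `valued_coe_zpow_apply`; brings ★ TorusCompactPart (`isCompact_unitsIntegers`, `mem_unitsIntegers_iff`)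
import Summits.HodgeConjecture.HodgeConjecture.Theorems.F0P3cStCharTSLocalRingNormDictionary    -- ★ `unitModulusChar_lt_one_iff` (`‖u‖ < 1 ↔ |u_w|_w < 1`); brings ★ `valued_conjLocal_apply_of_smul_eq`
import Summits.HodgeConjecture.HodgeConjecture.Theorems.F0P3cStCharTSWeylFixedIffNormTrivial    -- ★ `cmWeylTorusCharPair_eq_iff` (`wχ = χ ↔ ∀ α, χ₁(ᾱ) χ₁(α) = 1`)
import Summits.HodgeConjecture.HodgeConjecture.Theorems.F0P2oK1wOfWeylConj                     -- ★ `unitModulusChar_units_map_of_involutive` (`‖σ a‖ = ‖a‖`)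
import Summits.HodgeConjecture.HodgeConjecture.Theorems.F0P2pTorusPairsAndVacuity               -- ★ `conjInvChar_apply`-level kit: `continuous_coe_conjInvChar`, `conjInvChar_conjInvChar`
import HarnessLib

/-!
# K2 ∕ E3 «EllipticInputs», unit U4 «Keys» — «WE MAY ASSUME `Re s > 0`», part 2: the shape `|χ₁| = ‖·‖_E^s` of a continuous quasi-character of `E_vˣ`
# at a non-split place — `|χ₁| = 1` on `𝒪_vˣ`, `|χ₁(x)| = |χ₁(ϖ)|^{ord x}`, `|χ₁(x̄)| = |χ₁(x)|`, NON-UNITARY ⇒ REGULAR, and the CONTRACTING ∕ EXPANDING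
# DICHOTOMY [Keys1984 §1 p. 116 «`λ_s(x) = λ(x)|x|_E^s`», §7 p. 126 «We may assume Re λ > 0», «Note that `wλ = λ` iff `λ(x x̄) = 1`»; WeilBNT1967 I §4]

Cell hodgecm-mathlib (D-0151), FLOOR 0, Track B «K2-LIT», engine E3, crux item H413 = stmt-HodgeConjecture-24833 (route `HCCMUnconditional`, no route verbs);
SIGS-TABLE-K2E3 row #5 (U4-b) residue [Keys1984 §7 Thm (2)] (★ `K2E3CompZeroKeysListRegularOfKeysThmTwo` p854986, hypothesis `hK` over NON-UNITARY `χ₁`).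
Keys parametrises a quasi-character of `E^×` as `λ_s = λ|·|_E^s`, `λ` unitary, and proves Theorem (2) for `Re s > 0` («We may assume Re λ > 0», by `w`); this file
supplies, in the organ's currency (`χ₁ : (Π_{w∣v} L_w)ˣ →* ℂˣ` continuous, `v` non-split, modulus ★ `unitModulusChar`), the elementary structure that makes
«non-unitary» split into «contracting» (`Re s > 0`: `‖x‖ < 1 ⇒ |χ₁ x| < 1`) or «expanding» (`Re s < 0`), exchanged by `χ₁ ↦ χ̄₁⁻¹` (★ `conjInvChar`), and that
makes a non-unitary `χ = (χ₁, χ₂)` REGULAR (`wχ ≠ χ`).  Author K2E3-p05 (g0).  `--supports stmt-HodgeConjecture-24833 --as helper`; THEOREMS ONLY.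

THE MATHEMATICS (`R = Π_{w∣v} L_w` is ONE local field at a non-split `v`; `E_vˣ = ϖ^ℤ · 𝒪_vˣ`, ★ `exists_zpow_mul_of_nonsplit`; `𝒪_vˣ` compact, ★ `isCompact_unitsIntegers`):
* §1 `norm_apply_eq_one_of_mem_unitsIntegers` — a continuous `χ₁` is unitary on the compact `𝒪_vˣ` (bounded powers); any finite `v`.
* §2 `exists_uniformizer_zpow_mul` — `x = ϖⁿ u`, `u ∈ 𝒪_vˣ`, `|x_w|_w = exp(−n)`; `norm_apply_eq_norm_uniformizer_zpow` — `|χ₁ x| = |χ₁ ϖ|ⁿ`;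
  `norm_apply_conj_eq` — `|χ₁(x̄)| = |χ₁(x)|` (`x̄ = ϖⁿ u′`, same `n`: `σ` is an isometry, ★ `valued_conjLocal_apply_of_smul_eq`).
* §3 `cmTorusCharPair_ne_weyl_of_exists_norm_ne_one` — **NON-UNITARY ⇒ REGULAR**: `wχ = χ` means `χ₁(x̄) χ₁(x) = 1` (★ `cmWeylTorusCharPair_eq_iff`), whose
  absolute value with §2 reads `|χ₁ x|² = 1`.  [Keys1984 §7 «`wλ = λ` iff `λ(x x̄) = 1`»; Rogawski1990 §12.2.]
* §4 `contracting_or_expanding_of_exists_norm_ne_one` — **THE DICHOTOMY**: if `|χ₁ x₀| ≠ 1` for some `x₀` then `c := |χ₁ ϖ| ≠ 1` and, since `‖x‖ < 1` means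
  `x = ϖⁿ u` with `n ≥ 1` (★ `unitModulusChar_lt_one_iff`), EITHER `‖x‖ < 1 ⇒ |χ₁ x| < 1` for all `x` (`c < 1`, «`Re s > 0`») OR `‖x‖ < 1 ⇒ |χ₁ x| > 1` for all
  `x` (`c > 1`, «`Re s < 0`»).
* §5 `exists_norm_conjInvChar_ne_one`, `conjInvChar_contracting_of_expanding` — `χ̄₁⁻¹` is again non-unitary, and contracting when `χ₁` is expanding
  (`|χ̄₁⁻¹(x)| = |χ₁(x̄)|⁻¹`, `‖x̄‖ = ‖x‖` ★ `unitModulusChar_units_map_of_involutive`).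
With ★ `K2E3PrincipalSeriesWeylReducible` (reducibility of `i_G(χ)` passes to `i_G(wχ)`) these reduce the hypothesis `hK` of ★ p854986 to Keys' printed normal form
«`Re s > 0`: a reducible contracting non-unitary `i_G(χ₁, χ₂)` has `χ₁ = ‖·‖` or `χ₁ = η‖·‖^{1/2}`» (assembly in the sequel file, once both modules are built).
HONEST LABEL: HC_CM is proved only modulo the 7 printed citations (2 remaining named inputs: hLiu418 = stmt-HodgeConjecture-24832, h413 = stmt-HodgeConjecture-24833)
until rung 0 closes; count-neutral (elementary structure of quasi-characters made available in house; no printed citation is discharged).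

## References
* [Keys1984] D. Keys, Compositio Math. 51 (1984), §1 p. 116 («`λ_s(x) = λ(x)|x|^s_E`»), §7 p. 126 («We may assume `Re λ > 0`», «`wλ = λ` if and only if `λ(xx̄) = 1`»).
* [WeilBNT1967] A. Weil, *Basic Number Theory* (1967), Ch. I §4 (`K^× = π^ℤ × R^×`, the module), Ch. I §2.
* [Rogawski1990] J. D. Rogawski, Ann. of Math. Stud. 123 (1990), §12.1 p. 171, §12.2 p. 173 («`w(χ₁, χ₂) = (χ̄₁⁻¹, χ₂)`», `‖·‖_E`).
-/

set_option autoImplicit false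
-- the mandated namespace has the single-problem summit's repeated segment (`HodgeConjecture.HodgeConjecture`)
set_option linter.dupNamespace false

noncomputable section

open NumberField IsDedekindDomain MeasureTheory Topology Filter
open Literature.NumberTheory.Automorphic Literature.NumberTheory.Automorphic.UnitaryGroup

namespace Summit.HodgeConjecture.HodgeConjecture.Cruxes.H413.K2E3NonUnitaryCharacterDichotomy

variable (L : Type) [Field L] [NumberField L] [IsCMField L] (v : HeightOneSpectrum (𝓞 ↥(maximalRealSubfield L)))

/-! ## §1 A continuous quasi-character is unitary on the compact `𝒪_vˣ` -/

omit [IsCMField L] in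
/-- **`|χ₁| = 1` on `𝒪_vˣ`** for a continuous `χ₁ : E_vˣ → ℂˣ` (`𝒪_vˣ` = the units of `Π_{w∣v} 𝒪_w`, compact ★ `isCompact_unitsIntegers`; the norms of the values of a
continuous character on a compact subgroup form a bounded subgroup of `ℝ_{>0}`, hence are `1`).  Any finite `v`. [cite: WeilBNT1967, Ch. I §4] [cite: Keys1984, §1 p. 116] -/
theorem norm_apply_eq_one_of_mem_unitsIntegers (χ₁ : (LocalRing L v)ˣ →* ℂˣ) (h₁ : Continuous fun x => ((χ₁ x : ℂˣ) : ℂ))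
    (u : (LocalRing L v)ˣ)
    (hu : u ∈ (Submonoid.pi Set.univ (fun w : PlacesOver L v => (w.1.adicCompletionIntegers L).toSubring.toSubmonoid)).units) :
    ‖((χ₁ u : ℂˣ) : ℂ)‖ = 1 := by
  set K : Subgroup (LocalRing L v)ˣ :=
    (Submonoid.pi Set.univ (fun w : PlacesOver L v => (w.1.adicCompletionIntegers L).toSubring.toSubmonoid)).units with hKdef
  have hK : IsCompact (K : Set (LocalRing L v)ˣ) := F0P3cStCharTSTorusCompactPart.isCompact_unitsIntegers L v
  have hc : Continuous fun x : (LocalRing L v)ˣ => ‖((χ₁ x : ℂˣ) : ℂ)‖ := continuous_norm.comp h₁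
  obtain ⟨M, hM⟩ := (hK.image hc).isBounded.bddAbove
  have hle : ∀ y ∈ K, ‖((χ₁ y : ℂˣ) : ℂ)‖ ≤ 1 := fun y hy => not_lt.mp fun hlt => by
    obtain ⟨m, hm⟩ := pow_unbounded_of_one_lt M hlt
    have hm' : ‖((χ₁ y : ℂˣ) : ℂ)‖ ^ m ≤ M := by
      have := hM (Set.mem_image_of_mem (fun x : (LocalRing L v)ˣ => ‖((χ₁ x : ℂˣ) : ℂ)‖) (K.pow_mem hy m))
      simpa only [map_pow, Units.val_pow_eq_pow_val, norm_pow] using this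
    exact absurd hm' (not_le.mpr hm)
  refine le_antisymm (hle u hu) ?_
  have h1 := hle u⁻¹ (K.inv_mem hu)
  rw [map_inv, Units.val_inv_eq_inv_val, norm_inv] at h1
  exact (inv_le_one₀ (norm_pos_iff.mpr (Units.ne_zero _))).mp h1

/-! ## §2 `x = ϖⁿ u` and `|χ₁ x| = |χ₁ ϖ|ⁿ`; `|χ₁(x̄)| = |χ₁(x)|` -/

/-- **`E_vˣ = ϖ^ℤ · 𝒪_vˣ` on the nose** (`v` non-split): every unit is `x = ϖⁿ · u` with `u ∈ 𝒪_vˣ` and `|x_w|_w = exp(−n)` at every `w ∣ v`, for any uniformiser unit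
`ϖ` (★ `exists_zpow_mul_of_nonsplit`, read on the first factor of `M = E_vˣ × E¹_v`). [cite: WeilBNT1967, Ch. I §4] -/
theorem exists_uniformizer_zpow_mul (hns : ∀ w : PlacesOver L v, IsCMField.complexConj L • w.1 = w.1)
    (ϖ : (LocalRing L v)ˣ) (hϖ : ∀ w : PlacesOver L v, Valued.v ((ϖ : LocalRing L v) w) = WithZero.exp (-1 : ℤ)) (x : (LocalRing L v)ˣ) :
    ∃ (n : ℤ) (u : (LocalRing L v)ˣ),
      u ∈ (Submonoid.pi Set.univ (fun w : PlacesOver L v => (w.1.adicCompletionIntegers L).toSubring.toSubmonoid)).units ∧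
      x = ϖ ^ n * u ∧ ∀ w : PlacesOver L v, Valued.v ((x : LocalRing L v) w) = WithZero.exp (-n) := by
  obtain ⟨n, u, hu, hxu⟩ := F0P3cStCharTSTorusRay.exists_zpow_mul_of_nonsplit L v hns ϖ hϖ 1 (x, 1)
  have hu1 : u.1 ∈ (Submonoid.pi Set.univ (fun w : PlacesOver L v => (w.1.adicCompletionIntegers L).toSubring.toSubmonoid)).units :=
    (Subgroup.mem_prod.1 hu).1
  have hx : x = ϖ ^ n * u.1 := congrArg Prod.fst hxu
  refine ⟨n, u.1, hu1, hx, fun w => ?_⟩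
  rw [hx, Units.val_mul, Pi.mul_apply, map_mul, F0P3cStCharTSTorusRay.valued_coe_zpow_apply L v ϖ n w, hϖ,
    (F0P3cStCharTSTorusCompactPart.mem_unitsIntegers_iff L v u.1).1 hu1 w, mul_one, ← WithZero.exp_zsmul, smul_eq_mul, mul_neg, mul_one]

omit [IsCMField L] in
/-- **`|χ₁ x| = |χ₁ ϖ|ⁿ` for `x = ϖⁿ u`, `u ∈ 𝒪_vˣ`** (§1).  Any finite `v`. [cite: Keys1984, §1 p. 116] [cite: WeilBNT1967, Ch. I §4] -/
theorem norm_apply_eq_norm_uniformizer_zpow (χ₁ : (LocalRing L v)ˣ →* ℂˣ) (h₁ : Continuous fun x => ((χ₁ x : ℂˣ) : ℂ))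
    (ϖ u : (LocalRing L v)ˣ) (n : ℤ)
    (hu : u ∈ (Submonoid.pi Set.univ (fun w : PlacesOver L v => (w.1.adicCompletionIntegers L).toSubring.toSubmonoid)).units) :
    ‖((χ₁ (ϖ ^ n * u) : ℂˣ) : ℂ)‖ = ‖((χ₁ ϖ : ℂˣ) : ℂ)‖ ^ n := by
  rw [map_mul, map_zpow, Units.val_mul, Units.val_zpow_eq_zpow_val, norm_mul, norm_zpow,
    norm_apply_eq_one_of_mem_unitsIntegers L v χ₁ h₁ u hu, mul_one]

/-- **The exponent is the valuation**: if `x = ϖⁿ u = ϖ^{n′} u′` read through `|x_w|_w`, then `|χ₁ x|` depends on `x` only through `|x_w|_w` — stated as: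
`|x_w|_w = |y_w|_w` at the place(s) above `v` ⇒ `|χ₁ x| = |χ₁ y|` (`v` non-split). [cite: WeilBNT1967, Ch. I §4] [cite: Keys1984, §1 p. 116] -/
theorem norm_apply_eq_of_valued_eq (hns : ∀ w : PlacesOver L v, IsCMField.complexConj L • w.1 = w.1)
    (χ₁ : (LocalRing L v)ˣ →* ℂˣ) (h₁ : Continuous fun x => ((χ₁ x : ℂˣ) : ℂ)) (x y : (LocalRing L v)ˣ)
    (hxy : ∀ w : PlacesOver L v, Valued.v ((x : LocalRing L v) w) = Valued.v ((y : LocalRing L v) w)) :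
    ‖((χ₁ x : ℂˣ) : ℂ)‖ = ‖((χ₁ y : ℂˣ) : ℂ)‖ := by
  obtain ⟨ϖ, hϖ⟩ := F0P3cStCharTSTorusRay.exists_uniformizer_units L v
  obtain ⟨n, u, hu, hx, hvx⟩ := exists_uniformizer_zpow_mul L v hns ϖ hϖ x
  obtain ⟨n', u', hu', hy, hvy⟩ := exists_uniformizer_zpow_mul L v hns ϖ hϖ y
  obtain ⟨w⟩ := (inferInstance : Nonempty (PlacesOver L v))
  have hnn : n = n' := by
    have h := hxy w
    rw [hvx w, hvy w, WithZero.exp_inj, neg_inj] at h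
    exact h
  rw [hx, hy, norm_apply_eq_norm_uniformizer_zpow L v χ₁ h₁ ϖ u n hu, norm_apply_eq_norm_uniformizer_zpow L v χ₁ h₁ ϖ u' n' hu', hnn]

/-- **`|χ₁(x̄)| = |χ₁(x)|`** (`v` non-split: `σ = c ⊗ 1` is an isometry at the one place above `v`, ★ `valued_conjLocal_apply_of_smul_eq`). [cite: Keys1984, §7 p. 126] [cite: Rogawski1990, §12.2 p. 173] -/
theorem norm_apply_conj_eq (hns : ∀ w : PlacesOver L v, IsCMField.complexConj L • w.1 = w.1)
    (χ₁ : (LocalRing L v)ˣ →* ℂˣ) (h₁ : Continuous fun x => ((χ₁ x : ℂˣ) : ℂ)) (x : (LocalRing L v)ˣ) :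
    ‖((χ₁ (Units.map (conjLocal L (IsCMField.complexConj L) v : LocalRing L v →* LocalRing L v) x) : ℂˣ) : ℂ)‖ = ‖((χ₁ x : ℂˣ) : ℂ)‖ :=
  norm_apply_eq_of_valued_eq L v hns χ₁ h₁ _ x fun w => by
    rw [Units.coe_map, MonoidHom.coe_coe]
    exact valued_conjLocal_apply_of_smul_eq L v w (hns w) (x : LocalRing L v)

/-! ## §3 Non-unitary ⇒ regular -/

/-- **A NON-UNITARY `χ = (χ₁, χ₂)` IS REGULAR: `wχ ≠ χ`** (`v` non-split, `χ₁` continuous with `|χ₁ x₀| ≠ 1` for some `x₀`).  For `wχ = χ` reads `χ₁(x̄) χ₁(x) = 1`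
for all `x` (★ `cmWeylTorusCharPair_eq_iff`), and taking absolute values with §2 gives `|χ₁ x|² = 1`.  (Keys: «Note that `wλ = λ` if and only if `λ(x x̄) = 1`»; so
Theorem (2), about non-unitary `λ_s`, is a statement about regular characters.) [cite: Keys1984, §7 p. 126] [cite: Rogawski1990, §12.2 p. 173] -/
theorem cmTorusCharPair_ne_weyl_of_exists_norm_ne_one (hns : ∀ w : PlacesOver L v, IsCMField.complexConj L • w.1 = w.1)
    (χ₁ : (LocalRing L v)ˣ →* ℂˣ) (χ₂ : ↥(normOneUnits (conjLocal L (IsCMField.complexConj L) v)) →* ℂˣ)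
    (h₁ : Continuous fun x => ((χ₁ x : ℂˣ) : ℂ)) (hnu : ∃ x, ‖((χ₁ x : ℂˣ) : ℂ)‖ ≠ 1) :
    cmTorusCharPair L v χ₁ χ₂ ≠ cmTorusCharPair L v (conjInvChar (conjLocal L (IsCMField.complexConj L) v) χ₁) χ₂ := by
  intro heq
  obtain ⟨x, hx⟩ := hnu
  have hw : cmWeylTorusCharPair L v χ₁ χ₂ = cmTorusCharPair L v χ₁ χ₂ := (cmWeylTorusCharPair_eq L v χ₁ χ₂).trans heq.symm
  have h := (F0P3cStCharTSWeylFixedIffNormTrivial.cmWeylTorusCharPair_eq_iff L v χ₁ χ₂).1 hw x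
  have hn : ‖((χ₁ (Units.map (conjLocal L (IsCMField.complexConj L) v : LocalRing L v →* LocalRing L v) x) : ℂˣ) : ℂ)‖ * ‖((χ₁ x : ℂˣ) : ℂ)‖ = 1 := by
    rw [← norm_mul, ← Units.val_mul, h, Units.val_one, norm_one]
  rw [norm_apply_conj_eq L v hns χ₁ h₁ x] at hn
  exact hx (by nlinarith [norm_nonneg ((χ₁ x : ℂˣ) : ℂ)])

/-! ## §4 The contracting ∕ expanding dichotomy -/

/-- **THE DICHOTOMY** (`v` non-split, `χ₁` continuous, `|χ₁ x₀| ≠ 1` for some `x₀`): EITHER `χ₁` is CONTRACTING — `‖x‖ < 1 ⇒ |χ₁ x| < 1` for every unit `x`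
(Keys' «`Re s > 0`») — OR EXPANDING — `‖x‖ < 1 ⇒ |χ₁ x| > 1` («`Re s < 0`»).  (`c := |χ₁ ϖ| ≠ 1` by §1–§2; `‖x‖ < 1` iff `x = ϖⁿ u` with `n ≥ 1`, ★
`unitModulusChar_lt_one_iff`; then `|χ₁ x| = cⁿ`.) [cite: Keys1984, §1 p. 116; §7 p. 126] [cite: WeilBNT1967, Ch. I §4] -/
theorem contracting_or_expanding_of_exists_norm_ne_one (hns : ∀ w : PlacesOver L v, IsCMField.complexConj L • w.1 = w.1)
    (χ₁ : (LocalRing L v)ˣ →* ℂˣ) (h₁ : Continuous fun x => ((χ₁ x : ℂˣ) : ℂ)) (hnu : ∃ x, ‖((χ₁ x : ℂˣ) : ℂ)‖ ≠ 1) :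
    (∀ x : (LocalRing L v)ˣ, unitModulusChar (LocalRing L v) x < 1 → ‖((χ₁ x : ℂˣ) : ℂ)‖ < 1) ∨
    (∀ x : (LocalRing L v)ˣ, unitModulusChar (LocalRing L v) x < 1 → 1 < ‖((χ₁ x : ℂˣ) : ℂ)‖) := by
  obtain ⟨ϖ, hϖ⟩ := F0P3cStCharTSTorusRay.exists_uniformizer_units L v
  obtain ⟨x₀, hx₀⟩ := hnu
  -- `c := |χ₁ ϖ| ≠ 1`
  have hc1 : ‖((χ₁ ϖ : ℂˣ) : ℂ)‖ ≠ 1 := by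
    intro hc
    obtain ⟨n, u, hu, hx, -⟩ := exists_uniformizer_zpow_mul L v hns ϖ hϖ x₀
    apply hx₀
    rw [hx, norm_apply_eq_norm_uniformizer_zpow L v χ₁ h₁ ϖ u n hu, hc, one_zpow]
  have hc0 : 0 < ‖((χ₁ ϖ : ℂˣ) : ℂ)‖ := norm_pos_iff.mpr (Units.ne_zero _)
  -- `‖x‖ < 1` ⇒ `x = ϖⁿ u` with `0 < n`
  have hexp : ∀ x : (LocalRing L v)ˣ, unitModulusChar (LocalRing L v) x < 1 →
      ∃ n : ℤ, 0 < n ∧ ‖((χ₁ x : ℂˣ) : ℂ)‖ = ‖((χ₁ ϖ : ℂˣ) : ℂ)‖ ^ n := by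
    intro x hx
    obtain ⟨n, u, hu, hxe, hvx⟩ := exists_uniformizer_zpow_mul L v hns ϖ hϖ x
    obtain ⟨w⟩ := (inferInstance : Nonempty (PlacesOver L v))
    have hvlt : Valued.v ((x : LocalRing L v) w) < 1 :=
      (F0P3cStCharTSLocalRingNormDictionary.unitModulusChar_lt_one_iff L v w (hns w) x).1 hx
    rw [hvx w, ← WithZero.exp_zero, WithZero.exp_lt_exp, neg_lt_zero] at hvlt
    refine ⟨n, hvlt, ?_⟩
    rw [hxe, norm_apply_eq_norm_uniformizer_zpow L v χ₁ h₁ ϖ u n hu]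
  rcases lt_or_gt_of_ne hc1 with hlt | hgt
  · refine Or.inl fun x hx => ?_
    obtain ⟨n, hn, hxn⟩ := hexp x hx
    rw [hxn]
    exact zpow_lt_one₀ hc0 hlt hn
  · refine Or.inr fun x hx => ?_
    obtain ⟨n, hn, hxn⟩ := hexp x hx
    rw [hxn]
    exact one_lt_zpow₀ hgt hn

/-! ## §5 The Weyl flip `χ₁ ↦ χ̄₁⁻¹` exchanges expanding and contracting -/

/-- **`χ̄₁⁻¹` is non-unitary when `χ₁` is** (`|χ̄₁⁻¹(x̄₀)| = |χ₁(x₀)|⁻¹ ≠ 1`, `σ² = 1`). [cite: Keys1984, §7 p. 126] [cite: Rogawski1990, §12.2 p. 173] -/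
theorem exists_norm_conjInvChar_ne_one (χ₁ : (LocalRing L v)ˣ →* ℂˣ) (hnu : ∃ x, ‖((χ₁ x : ℂˣ) : ℂ)‖ ≠ 1) :
    ∃ x, ‖((conjInvChar (conjLocal L (IsCMField.complexConj L) v) χ₁ x : ℂˣ) : ℂ)‖ ≠ 1 := by
  obtain ⟨x₀, hx₀⟩ := hnu
  refine ⟨Units.map (conjLocal L (IsCMField.complexConj L) v : LocalRing L v →* LocalRing L v) x₀, fun h => hx₀ ?_⟩
  have hσσ : Units.map (conjLocal L (IsCMField.complexConj L) v : LocalRing L v →* LocalRing L v)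
      (Units.map (conjLocal L (IsCMField.complexConj L) v : LocalRing L v →* LocalRing L v) x₀) = x₀ :=
    Units.ext (conjLocal_conjLocal_cm L v (x₀ : LocalRing L v))
  rw [conjInvChar_apply, hσσ, Units.val_inv_eq_inv_val, norm_inv, inv_eq_one] at h
  exact h

/-- **The flip of an EXPANDING `χ₁` is CONTRACTING**: if `‖x‖ < 1 ⇒ |χ₁ x| > 1` then `‖x‖ < 1 ⇒ |χ̄₁⁻¹ x| < 1` (`|χ̄₁⁻¹(x)| = |χ₁(x̄)|⁻¹` and `‖x̄‖ = ‖x‖`, ★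
`unitModulusChar_units_map_of_involutive`) — Keys' «We may assume `Re λ > 0`». [cite: Keys1984, §7 p. 126] [cite: Rogawski1990, §12.2 p. 173] -/
theorem conjInvChar_contracting_of_expanding (χ₁ : (LocalRing L v)ˣ →* ℂˣ)
    (hexp : ∀ x : (LocalRing L v)ˣ, unitModulusChar (LocalRing L v) x < 1 → 1 < ‖((χ₁ x : ℂˣ) : ℂ)‖) (x : (LocalRing L v)ˣ)
    (hx : unitModulusChar (LocalRing L v) x < 1) :
    ‖((conjInvChar (conjLocal L (IsCMField.complexConj L) v) χ₁ x : ℂˣ) : ℂ)‖ < 1 := by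
  have hσx : unitModulusChar (LocalRing L v) (Units.map (conjLocal L (IsCMField.complexConj L) v : LocalRing L v →* LocalRing L v) x) < 1 := by
    rw [F0P2oK1wOfWeylConj.unitModulusChar_units_map_of_involutive (conjLocal L (IsCMField.complexConj L) v)
      (continuous_conjLocal L (IsCMField.complexConj L) v) (conjLocal_conjLocal_cm L v) x]
    exact hx
  have h1 := hexp _ hσx
  rw [conjInvChar_apply, Units.val_inv_eq_inv_val, norm_inv]
  exact inv_lt_one_of_one_lt₀ h1

end Summit.HodgeConjecture.HodgeConjecture.Cruxes.H413.K2E3NonUnitaryCharacterDichotomy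

end
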